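import Summits.QuantumFields.BalabanUV.Beta.FP.BlockAveragedKernel

/-!
# `BalabanUV.Beta.FP.LatticeConvolutionBounds` — road «FP» for binder row D1, row H′2-IR ∕ IR-4 deliverable (B): GENERIC POWER COUNTING FOR
# CONVOLUTIONS OF POLYNOMIAL PROFILES ON `ℤ⁴` — summability of `(‖v‖∞+1)^{−t}` for `t ≥ 5` with the explicit constant `81`, the TWO-CENTRE bound
# `∑'_v (‖v−p‖∞+1)^{−a}(‖v−q‖∞+1)^{−b} ≤ 162·(2∕(‖p−q‖∞+2))^s` whenever `a + b = t + s`, `t ≥ 5`, `s ≤ a`, `s ≤ b`, its kernel∘profile forms, and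
# the exponential ⟹ polynomial downgrade `e^{−δr} ≤ (e^δ·B!∕δ^B)·(r+1)^{−B}`

HONEST DEPENDENCY (page 1, mandatory): continuum YM on T⁴ ⇐ BetaPertH ∧ nine spine estimates (0/9 proved); BetaPertH ⇐ (D1) ∧ (D4) ∧
CAP+tail; G-an2-4 gates asym, D1 and NE2/3/4.  HONEST FRAMING (cell contract, verbatim): «discharging `BetaPertH` makes Bałaban's UV
stability UNCONDITIONAL — a real constructive-QFT result; it is NOT the continuum limit and NOT the Clay problem.»  THIS MODULE is [folklore]
elementary analysis on the lattice `ℤ⁴` (Mathlib + the tree's sup-norm ∕ shell-count API `DyadicShell`, `TransferUV.card_annulus_succ_four_le`,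
`BlockLegs.supNorm_sub_le_real`, gan24-leaf-04's `FP/BlockAveragedKernel.box_four_zero`); NO road object, no `def`, no `def … : Prop`, nothing cited, 0 sorry.  It is the bookkeeping brick announced in the
IR-4 statement-first CLAIM (journal 2026-08-20T20:29Z): the coarse-inverse ∘ block-profile sums of H′2-IR (`R_n^{Q} = P Q_nᵀ (Q_nPQ_nᵀ)⁻¹ Q_n P`,
the ghost twin `G₀Q′ᵀ(Q′G₀Q′ᵀ)⁻¹Q′G₀`) are exactly such two-centre convolutions.  0∕4 binders of row D1; NOT D1, NOT BetaPertH, NOT continuum, NOT Clay.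

ABSOLUTE RULE (cell charter, verbatim): «No internally-minted statement may enter as a cited fact. Every hypothesis is either kernel-proved in
this package or a verbatim quotation of a PUBLISHED theorem with page reference. The manuscript(s) under audit are NOT citable for their own
disputed steps — they are the thing under adjudication; programme-internal (2001/route/tribunal) claims are never citable.»

CONTENT (`Pt = Fin 4 → ℤ`, `‖·‖ = DyadicShell.supNorm`; all exponents natural numbers; all constants explicit).
* §1 ONE CENTRE: `sum_box_inv_pow_five_le` (`∑_{v ∈ box L} (‖v‖+1)^{−5} ≤ 81`, shells `#{‖v‖ = r+1} ≤ 80(r+1)³` (`DyadicShell.supNorm_eq_of_mem_sphere`) and the telescoping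
  `∑ 1∕((r+1)(r+2)) ≤ 1`), `summable_inv_pow` ∕ `tsum_inv_pow_le` (`t ≥ 5`: summable, `∑' ≤ 81`), shifted forms `…_sub`.
* §2 THE TWO-CENTRE POINTWISE INEQUALITY `inv_mul_pow_le` (real: `1 ≤ x, y`, `m ≤ x + y`, `a + b = t + s`, `s ≤ a, b` ⟹
  `1∕(x^a y^b) ≤ (2∕m)^s (1∕x^t + 1∕y^t)`) and its lattice form `inv_profile_mul_le` with `m = ‖p − q‖ + 2`.
* §3 TWO CENTRES: **`summable_two_centre`**, **`tsum_two_centre_le`** (`∑'_v (‖v−p‖+1)^{−a}(‖v−q‖+1)^{−b} ≤ 162·(2∕(‖p−q‖+2))^s`), and the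
  KERNEL ∘ PROFILE forms **`tsum_kernel_profile_le`** (`|K v| ≤ κ(‖v−p‖+1)^{−B}`, `|f v| ≤ A(‖v−q‖+1)^{−a}`, `5 ≤ B`, `a ≤ B` ⟹
  `|∑' K·f| ≤ κ·A·162·2^a∕(‖p−q‖+2)^a` — an exponentially∕`B`-polynomially local kernel REPRODUCES a degree-`a` profile) and
  **`tsum_profile_profile_le`** (`a + b ≥ 5` ⟹ `|∑' f·g| ≤ A·A′·162` — two profiles of total degree `> 4` have a bounded overlap sum, although
  neither need be summable alone: the `(2,3)` case of IR-4's `Σ_u A(x,u)·W(u,x′)`).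
* §4 `exp_neg_mul_le_div_pow` (`0 < δ`, `0 ≤ r` ⟹ `exp(−δr) ≤ (exp δ · B! ∕ δ^B) ∕ (r+1)^B`): an exponentially local kernel is `B`-polynomially
  local for every `B`, so §3 applies to `e^{−δ‖u−v‖}` kernels with `B = 5` (or `B = a` when `a > 5`).
Provenance: D1 formalisation swarm, unit b2b-balaban-beta-d1-formalise-leaf-05 gen 9 (prover-b2b-balaban-beta-d1-formalise-leaf-05-g9-0),
2026-08-20; `LEAVES-FP.md` row H′2-IR ∕ IR-4 (deliverable (B)).  [folklore], 0 def, 0 cite, 0 sorry.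
-/

namespace Summit.QuantumFields.BalabanUV.Beta.FP.LatticeConvolutionBounds

open Finset Real
open scoped BigOperators
open Literature.Probability.LatticeModels (box mem_box box_mono zero_mem_box annulus mem_annulus)
open Literature.MathematicalPhysics.QuantumFieldTheory.Balaban1983to89.Beta.TransferUV (card_annulus_succ_four_le sum_annulus_zero_eq_sum_shells)
open Literature.MathematicalPhysics.QuantumFieldTheory.Balaban1983to89.Beta.DyadicShell (Pt supNorm mem_box_iff mem_annulus_iff supNorm_eq_zero_iff
  supNorm_eq_of_mem_sphere)
open Literature.MathematicalPhysics.QuantumFieldTheory.Balaban1983to89.Beta.GradedBubbles (supNorm_neg)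
open Literature.MathematicalPhysics.QuantumFieldTheory.Balaban1983to89.Beta.BlockLegs (supNorm_sub_le_real supNorm_add_le_real)
open Summit.QuantumFields.BalabanUV.Beta.FP.BlockAveragedKernel (box_four_zero)

/-! ## §1 One centre: `∑_v (‖v‖∞+1)^{−t}`, `t ≥ 5` -/

/-- [folklore] **THE SHELL SUM**: `∑_{v ∈ box 4 L} (‖v‖∞+1)^{−5} ≤ 81` for every `L` (`1` from the origin, `80·∑_r (r+1)³∕(r+2)⁵ ≤ 80·∑_r 1∕((r+1)(r+2)) ≤ 80`). -/
theorem sum_box_inv_pow_five_le (L : ℕ) : ∑ v ∈ box 4 L, 1 / ((supNorm v : ℝ) + 1) ^ 5 ≤ 81 := by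
  have hsplit : ∑ v ∈ box 4 L, 1 / ((supNorm v : ℝ) + 1) ^ 5
      = ∑ v ∈ annulus 4 0 L, 1 / ((supNorm v : ℝ) + 1) ^ 5 + ∑ v ∈ box 4 0, 1 / ((supNorm v : ℝ) + 1) ^ 5 := by
    rw [annulus, Finset.sum_sdiff (box_mono 4 (Nat.zero_le L))]
  rw [hsplit, box_four_zero, Finset.sum_singleton, sum_annulus_zero_eq_sum_shells]
  have h0 : supNorm (0 : Pt) = 0 := supNorm_eq_zero_iff.mpr rfl
  rw [h0]
  simp only [Nat.cast_zero, zero_add, one_pow, div_one]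
  -- shells
  have hshell : ∀ r : ℕ, ∑ v ∈ annulus 4 r (r + 1), 1 / ((supNorm v : ℝ) + 1) ^ 5 ≤ 80 * (1 / ((r : ℝ) + 1) - 1 / ((r : ℝ) + 2)) := by
    intro r
    have hconst : ∑ v ∈ annulus 4 r (r + 1), 1 / ((supNorm v : ℝ) + 1) ^ 5
        = ((annulus 4 r (r + 1)).card : ℝ) * (1 / (((r : ℝ) + 1) + 1) ^ 5) := by
      rw [Finset.sum_congr rfl fun v hv => by rw [supNorm_eq_of_mem_sphere hv, Nat.cast_add, Nat.cast_one], Finset.sum_const,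
        nsmul_eq_mul]
    rw [hconst]
    have hc := card_annulus_succ_four_le r
    have hr : (0 : ℝ) ≤ r := Nat.cast_nonneg r
    have e1 : ((r : ℝ) + 1 + 1) = (r : ℝ) + 2 := by ring
    rw [e1]
    have key : 80 * ((r : ℝ) + 1) ^ 3 * (1 / ((r : ℝ) + 2) ^ 5) ≤ 80 * (1 / ((r : ℝ) + 1) - 1 / ((r : ℝ) + 2)) := by
      rw [div_sub_div _ _ (by positivity) (by positivity)]
      rw [mul_one_div, ← mul_div_assoc, div_le_div_iff₀ (by positivity) (by positivity)]
      nlinarith [pow_pos (show (0:ℝ) < r + 1 by positivity) 3, pow_pos (show (0:ℝ) < r + 2 by positivity) 3,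
        mul_pos (pow_pos (show (0:ℝ) < r + 1 by positivity) 3) (show (0:ℝ) < r + 2 by positivity)]
    calc ((annulus 4 r (r + 1)).card : ℝ) * (1 / ((r : ℝ) + 2) ^ 5)
        ≤ 80 * ((r : ℝ) + 1) ^ 3 * (1 / ((r : ℝ) + 2) ^ 5) := by gcongr
      _ ≤ _ := key
  have htel : ∀ M : ℕ, ∑ r ∈ Finset.range M, 80 * (1 / ((r : ℝ) + 1) - 1 / ((r : ℝ) + 2)) = 80 * (1 - 1 / ((M : ℝ) + 1)) := by
    intro M
    induction M with
    | zero => simp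
    | succ M ih =>
      rw [Finset.sum_range_succ, ih]
      push_cast
      ring
  calc ∑ r ∈ Finset.range L, ∑ v ∈ annulus 4 r (r + 1), 1 / ((supNorm v : ℝ) + 1) ^ 5 + 1
      ≤ ∑ r ∈ Finset.range L, 80 * (1 / ((r : ℝ) + 1) - 1 / ((r : ℝ) + 2)) + 1 := by
        gcongr with r hr
        exact hshell r
    _ = 80 * (1 - 1 / ((L : ℝ) + 1)) + 1 := by rw [htel]
    _ ≤ 81 := by
        have : 0 ≤ 1 / ((L : ℝ) + 1) := by positivity
        linarith

/-- [folklore] For `t ≥ 5` the box sums of `(‖v‖∞+1)^{−t}` are bounded by `81` too. -/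
theorem sum_box_inv_pow_le {t : ℕ} (ht : 5 ≤ t) (L : ℕ) : ∑ v ∈ box 4 L, 1 / ((supNorm v : ℝ) + 1) ^ t ≤ 81 := by
  refine le_trans (Finset.sum_le_sum fun v _ => ?_) (sum_box_inv_pow_five_le L)
  have h1 : (1 : ℝ) ≤ (supNorm v : ℝ) + 1 := by
    have := (Nat.cast_nonneg (supNorm v) : (0 : ℝ) ≤ supNorm v); linarith
  exact one_div_le_one_div_of_le (by positivity) (pow_le_pow_right₀ h1 ht)

/-- [folklore] Every finite set of lattice points lies in some box. -/
theorem exists_subset_box (S : Finset Pt) : ∃ L : ℕ, S ⊆ box 4 L := by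
  refine ⟨S.sup supNorm, fun v hv => mem_box_iff.mpr (Finset.le_sup hv)⟩

/-- [folklore] Finite partial sums of `(‖v‖∞+1)^{−t}` (`t ≥ 5`) are bounded by `81`. -/
theorem sum_inv_pow_le {t : ℕ} (ht : 5 ≤ t) (S : Finset Pt) : ∑ v ∈ S, 1 / ((supNorm v : ℝ) + 1) ^ t ≤ 81 := by
  obtain ⟨L, hL⟩ := exists_subset_box S
  exact le_trans (Finset.sum_le_sum_of_subset_of_nonneg hL fun v _ _ => by positivity) (sum_box_inv_pow_le ht L)

/-- [folklore] **SUMMABILITY**: `v ↦ (‖v‖∞+1)^{−t}` is summable on `ℤ⁴` for `t ≥ 5`. -/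
theorem summable_inv_pow {t : ℕ} (ht : 5 ≤ t) : Summable fun v : Pt => 1 / ((supNorm v : ℝ) + 1) ^ t :=
  summable_of_sum_le (fun v => by positivity) (sum_inv_pow_le ht)

/-- [folklore] `∑'_v (‖v‖∞+1)^{−t} ≤ 81` for `t ≥ 5`. -/
theorem tsum_inv_pow_le {t : ℕ} (ht : 5 ≤ t) : ∑' v : Pt, 1 / ((supNorm v : ℝ) + 1) ^ t ≤ 81 :=
  Real.tsum_le_of_sum_le (fun v => by positivity) (sum_inv_pow_le ht)

/-- [folklore] Shifted centre: summability of `v ↦ (‖v − p‖∞+1)^{−t}`. -/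
theorem summable_inv_pow_sub {t : ℕ} (ht : 5 ≤ t) (p : Pt) : Summable fun v : Pt => 1 / ((supNorm (v - p) : ℝ) + 1) ^ t :=
  (Equiv.subRight p).summable_iff.mpr (summable_inv_pow ht)

/-- [folklore] Shifted centre: `∑'_v (‖v − p‖∞+1)^{−t} ≤ 81`. -/
theorem tsum_inv_pow_sub_le {t : ℕ} (ht : 5 ≤ t) (p : Pt) : ∑' v : Pt, 1 / ((supNorm (v - p) : ℝ) + 1) ^ t ≤ 81 := by
  rw [show (∑' v : Pt, 1 / ((supNorm (v - p) : ℝ) + 1) ^ t) = ∑' v : Pt, 1 / ((supNorm v : ℝ) + 1) ^ t from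
    (Equiv.subRight p).tsum_eq (fun v : Pt => 1 / ((supNorm v : ℝ) + 1) ^ t)]
  exact tsum_inv_pow_le ht

/-! ## §2 The two-centre pointwise inequality -/

/-- [folklore] **TWO-CENTRE POINTWISE INEQUALITY** (real form): for `1 ≤ x`, `1 ≤ y`, `0 < m ≤ x + y` and exponents `a + b = t + s`, `s ≤ a`,
`s ≤ b`: `1∕(x^a·y^b) ≤ (2∕m)^s·(1∕x^t + 1∕y^t)` — the larger of `x, y` is `≥ m∕2` and absorbs `s` powers; the remaining `t` powers sit on
the smaller one. -/
theorem inv_mul_pow_le {x y m : ℝ} (hx : 1 ≤ x) (hy : 1 ≤ y) (hm : 0 < m) (hxy : m ≤ x + y) {a b s t : ℕ} (hab : a + b = t + s)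
    (hsa : s ≤ a) (hsb : s ≤ b) : 1 / (x ^ a * y ^ b) ≤ (2 / m) ^ s * (1 / x ^ t + 1 / y ^ t) := by
  have hx0 : 0 < x := by linarith
  have hy0 : 0 < y := by linarith
  rcases le_total x y with hle | hle
  · -- `y ≥ m/2`: `x^a y^b = y^s (x^a y^(b-s)) ≥ (m/2)^s x^t`
    obtain ⟨b', rfl⟩ := Nat.exists_eq_add_of_le hsb
    have ht : t = a + b' := by omega
    subst ht
    have hy2 : m / 2 ≤ y := by linarith
    have h1 : (m / 2) ^ s * x ^ (a + b') ≤ x ^ a * y ^ (s + b') := by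
      rw [pow_add x a b', pow_add y s b']
      have e : x ^ a * (y ^ s * y ^ b') = y ^ s * (x ^ a * y ^ b') := by ring
      rw [e]
      gcongr
    have hpos : 0 < (m / 2) ^ s * x ^ (a + b') := by positivity
    calc 1 / (x ^ a * y ^ (s + b')) ≤ 1 / ((m / 2) ^ s * x ^ (a + b')) := one_div_le_one_div_of_le hpos h1
      _ = (2 / m) ^ s * (1 / x ^ (a + b')) := by
          rw [one_div ((m / 2) ^ s * x ^ (a + b')), mul_inv, ← inv_pow, inv_div, one_div (x ^ (a + b'))]
      _ ≤ (2 / m) ^ s * (1 / x ^ (a + b') + 1 / y ^ (a + b')) := by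
          gcongr
          have : 0 ≤ 1 / y ^ (a + b') := by positivity
          linarith
  · obtain ⟨a', rfl⟩ := Nat.exists_eq_add_of_le hsa
    have ht : t = a' + b := by omega
    subst ht
    have hx2 : m / 2 ≤ x := by linarith
    have h1 : (m / 2) ^ s * y ^ (a' + b) ≤ x ^ (s + a') * y ^ b := by
      rw [pow_add x s a', pow_add y a' b]
      have e : x ^ s * x ^ a' * y ^ b = x ^ s * (x ^ a' * y ^ b) := by ring
      rw [e]
      gcongr
    have hpos : 0 < (m / 2) ^ s * y ^ (a' + b) := by positivity
    calc 1 / (x ^ (s + a') * y ^ b) ≤ 1 / ((m / 2) ^ s * y ^ (a' + b)) := one_div_le_one_div_of_le hpos h1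
      _ = (2 / m) ^ s * (1 / y ^ (a' + b)) := by
          rw [one_div ((m / 2) ^ s * y ^ (a' + b)), mul_inv, ← inv_pow, inv_div, one_div (y ^ (a' + b))]
      _ ≤ (2 / m) ^ s * (1 / x ^ (a' + b) + 1 / y ^ (a' + b)) := by
          gcongr
          have : 0 ≤ 1 / x ^ (a' + b) := by positivity
          linarith

/-! ## §3 Two centres -/

/-- [folklore] `1 ≤ ‖w‖∞ + 1` (real cast). -/
theorem one_le_supNorm_add_one (w : Pt) : (1 : ℝ) ≤ (supNorm w : ℝ) + 1 := by
  have := (Nat.cast_nonneg (supNorm w) : (0 : ℝ) ≤ supNorm w); linarith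

/-- [folklore] **TWO-CENTRE POINTWISE INEQUALITY ON THE LATTICE**: with `m := ‖p − q‖∞ + 2 ≤ (‖v − p‖∞ + 1) + (‖v − q‖∞ + 1)`. -/
theorem inv_profile_mul_le (p q v : Pt) {a b s t : ℕ} (hab : a + b = t + s) (hsa : s ≤ a) (hsb : s ≤ b) :
    1 / (((supNorm (v - p) : ℝ) + 1) ^ a * ((supNorm (v - q) : ℝ) + 1) ^ b)
      ≤ (2 / ((supNorm (p - q) : ℝ) + 2)) ^ s
          * (1 / ((supNorm (v - p) : ℝ) + 1) ^ t + 1 / ((supNorm (v - q) : ℝ) + 1) ^ t) := by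
  have hxy : (supNorm (p - q) : ℝ) + 2 ≤ ((supNorm (v - p) : ℝ) + 1) + ((supNorm (v - q) : ℝ) + 1) := by
    have h := supNorm_sub_le_real (v - q) (v - p)
    have e : (v - q) - (v - p) = p - q := by abel
    rw [e] at h
    linarith
  exact inv_mul_pow_le (one_le_supNorm_add_one _) (one_le_supNorm_add_one _) (by positivity) hxy hab hsa hsb

/-- [folklore] **SUMMABILITY OF THE TWO-CENTRE PRODUCT** for `a + b = t + s`, `s ≤ a`, `s ≤ b`, `t ≥ 5`. -/
theorem summable_two_centre (p q : Pt) {a b s t : ℕ} (hab : a + b = t + s) (hsa : s ≤ a) (hsb : s ≤ b) (ht : 5 ≤ t) :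
    Summable fun v : Pt => 1 / (((supNorm (v - p) : ℝ) + 1) ^ a * ((supNorm (v - q) : ℝ) + 1) ^ b) :=
  Summable.of_nonneg_of_le (fun v => by positivity) (fun v => inv_profile_mul_le p q v hab hsa hsb)
    (((summable_inv_pow_sub ht p).add (summable_inv_pow_sub ht q)).mul_left _)

/-- [folklore] **THE TWO-CENTRE SUM**: `∑'_v (‖v−p‖∞+1)^{−a}(‖v−q‖∞+1)^{−b} ≤ 162·(2∕(‖p−q‖∞+2))^s` for `a + b = t + s`, `s ≤ a`, `s ≤ b`, `t ≥ 5`.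
Special cases: `s = 0` — two profiles of total degree `≥ 5` have overlap sum `≤ 162`; `s = a ≤ b = t` with `b ≥ 5` — a `b`-local kernel reproduces the
degree-`a` profile with decay `(2∕(‖p−q‖+2))^a`. -/
theorem tsum_two_centre_le (p q : Pt) {a b s t : ℕ} (hab : a + b = t + s) (hsa : s ≤ a) (hsb : s ≤ b) (ht : 5 ≤ t) :
    ∑' v : Pt, 1 / (((supNorm (v - p) : ℝ) + 1) ^ a * ((supNorm (v - q) : ℝ) + 1) ^ b)
      ≤ 162 * (2 / ((supNorm (p - q) : ℝ) + 2)) ^ s := by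
  have hp := summable_inv_pow_sub ht p
  have hq := summable_inv_pow_sub ht q
  calc ∑' v : Pt, 1 / (((supNorm (v - p) : ℝ) + 1) ^ a * ((supNorm (v - q) : ℝ) + 1) ^ b)
      ≤ ∑' v : Pt, (2 / ((supNorm (p - q) : ℝ) + 2)) ^ s
          * (1 / ((supNorm (v - p) : ℝ) + 1) ^ t + 1 / ((supNorm (v - q) : ℝ) + 1) ^ t) :=
        (summable_two_centre p q hab hsa hsb ht).tsum_le_tsum (fun v => inv_profile_mul_le p q v hab hsa hsb)
          ((hp.add hq).mul_left _)
    _ = (2 / ((supNorm (p - q) : ℝ) + 2)) ^ s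
          * (∑' v : Pt, 1 / ((supNorm (v - p) : ℝ) + 1) ^ t + ∑' v : Pt, 1 / ((supNorm (v - q) : ℝ) + 1) ^ t) := by
        rw [tsum_mul_left, hp.tsum_add hq]
    _ ≤ (2 / ((supNorm (p - q) : ℝ) + 2)) ^ s * (81 + 81) := by
        gcongr
        · exact tsum_inv_pow_sub_le ht p
        · exact tsum_inv_pow_sub_le ht q
    _ = 162 * (2 / ((supNorm (p - q) : ℝ) + 2)) ^ s := by ring

/-- [folklore] A profile constant is non-negative: `|f v| ≤ A∕(‖v−p‖∞+1)^a` at `v` forces `0 ≤ A`. -/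
theorem nonneg_of_abs_le_div {f : Pt → ℝ} {A : ℝ} {p : Pt} {a : ℕ} (v : Pt) (hf : |f v| ≤ A / ((supNorm (v - p) : ℝ) + 1) ^ a) :
    0 ≤ A := by
  have hx : 0 < ((supNorm (v - p) : ℝ) + 1) ^ a := by positivity
  rw [le_div_iff₀ hx] at hf
  exact le_trans (mul_nonneg (abs_nonneg _) hx.le) hf

/-- [folklore] **TWO PROFILES, WEIGHTED**: if `|f v| ≤ A∕(‖v−p‖∞+1)^a`, `|g v| ≤ A′∕(‖v−q‖∞+1)^b` with `a + b = t + s`, `s ≤ a`, `s ≤ b`, `t ≥ 5`,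
then `v ↦ f v·g v` is summable and `|∑'_v f v·g v| ≤ A·A′·162·(2∕(‖p−q‖∞+2))^s`. -/
theorem abs_tsum_mul_le_of_profiles {f g : Pt → ℝ} {A A' : ℝ} (p q : Pt) {a b s t : ℕ} (hab : a + b = t + s) (hsa : s ≤ a)
    (hsb : s ≤ b) (ht : 5 ≤ t) (hf : ∀ v, |f v| ≤ A / ((supNorm (v - p) : ℝ) + 1) ^ a)
    (hg : ∀ v, |g v| ≤ A' / ((supNorm (v - q) : ℝ) + 1) ^ b) :
    Summable (fun v => f v * g v)
      ∧ |∑' v, f v * g v| ≤ A * A' * (162 * (2 / ((supNorm (p - q) : ℝ) + 2)) ^ s) := by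
  have hA : 0 ≤ A := nonneg_of_abs_le_div p (hf p)
  have hA' : 0 ≤ A' := nonneg_of_abs_le_div q (hg q)
  set m : ℝ := (supNorm (p - q) : ℝ) + 2 with hm
  -- the majorant
  set G : Pt → ℝ := fun v => A * A' * ((2 / m) ^ s
      * (1 / ((supNorm (v - p) : ℝ) + 1) ^ t + 1 / ((supNorm (v - q) : ℝ) + 1) ^ t)) with hG
  have hGs : Summable G := (((summable_inv_pow_sub ht p).add (summable_inv_pow_sub ht q)).mul_left _).mul_left _
  have hpt : ∀ v, |f v * g v| ≤ G v := by
    intro v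
    rw [abs_mul]
    calc |f v| * |g v| ≤ (A / ((supNorm (v - p) : ℝ) + 1) ^ a) * (A' / ((supNorm (v - q) : ℝ) + 1) ^ b) :=
          mul_le_mul (hf v) (hg v) (abs_nonneg _) (div_nonneg hA (by positivity))
      _ = A * A' * (1 / (((supNorm (v - p) : ℝ) + 1) ^ a * ((supNorm (v - q) : ℝ) + 1) ^ b)) := by
          rw [mul_one_div, div_mul_div_comm]
      _ ≤ G v := by
          rw [hG]
          exact mul_le_mul_of_nonneg_left (inv_profile_mul_le p q v hab hsa hsb) (mul_nonneg hA hA')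
  have habs : Summable fun v => |f v * g v| := Summable.of_nonneg_of_le (fun v => abs_nonneg _) hpt hGs
  have hsum : Summable fun v => f v * g v := habs.of_abs
  refine ⟨hsum, ?_⟩
  have hnorm : Summable fun v => ‖f v * g v‖ := by simpa only [Real.norm_eq_abs] using habs
  have h1 : |∑' v, f v * g v| ≤ ∑' v, |f v * g v| := by
    have := norm_tsum_le_tsum_norm hnorm
    simpa only [Real.norm_eq_abs] using this
  have h2 : ∑' v, |f v * g v| ≤ ∑' v, G v := habs.tsum_le_tsum hpt hGs
  have h3 : ∑' v, G v ≤ A * A' * (162 * (2 / m) ^ s) := by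
    rw [hG, tsum_mul_left, tsum_mul_left, (summable_inv_pow_sub ht p).tsum_add (summable_inv_pow_sub ht q)]
    have hS : ∑' v : Pt, 1 / ((supNorm (v - p) : ℝ) + 1) ^ t + ∑' v : Pt, 1 / ((supNorm (v - q) : ℝ) + 1) ^ t ≤ 162 := by
      have := tsum_inv_pow_sub_le ht p; have := tsum_inv_pow_sub_le ht q; linarith
    have h2m : 0 ≤ (2 / m) ^ s := by positivity
    calc A * A' * ((2 / m) ^ s * (∑' v : Pt, 1 / ((supNorm (v - p) : ℝ) + 1) ^ t
            + ∑' v : Pt, 1 / ((supNorm (v - q) : ℝ) + 1) ^ t))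
        ≤ A * A' * ((2 / m) ^ s * 162) := by gcongr
      _ = A * A' * (162 * (2 / m) ^ s) := by ring
  exact h1.trans (h2.trans h3)

/-- [folklore] **KERNEL ∘ PROFILE** (the coarse-inverse step of H′2-IR): a `B`-polynomially local kernel (`|K v| ≤ κ∕(‖v−p‖∞+1)^B`, `B ≥ 5`) against a
degree-`a` profile centred at `q` (`a ≤ B`) gives `|∑'_v K v·f v| ≤ κ·A·162·2^a∕(‖p−q‖∞+2)^a` — the profile is REPRODUCED at the kernel's centre. -/
theorem tsum_kernel_profile_le {K f : Pt → ℝ} {κ A : ℝ} (p q : Pt) {B a : ℕ} (hB : 5 ≤ B) (haB : a ≤ B)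
    (hK : ∀ v, |K v| ≤ κ / ((supNorm (v - p) : ℝ) + 1) ^ B) (hf : ∀ v, |f v| ≤ A / ((supNorm (v - q) : ℝ) + 1) ^ a) :
    Summable (fun v => K v * f v)
      ∧ |∑' v, K v * f v| ≤ κ * A * (162 * (2 / ((supNorm (p - q) : ℝ) + 2)) ^ a) :=
  abs_tsum_mul_le_of_profiles p q (a := B) (b := a) (s := a) (t := B) (by ring) haB le_rfl hB hK hf

/-- [folklore] **PROFILE ∘ PROFILE, BOUNDED OVERLAP** (the `Σ_u A(x,u)·W(u,x′)` step of IR-4): two profiles of total degree `a + b ≥ 5` have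
`|∑'_v f v·g v| ≤ A·A′·162`, although for `a, b ≤ 4` neither factor is summable on its own. -/
theorem tsum_profile_profile_le {f g : Pt → ℝ} {A A' : ℝ} (p q : Pt) {a b : ℕ} (hab : 5 ≤ a + b)
    (hf : ∀ v, |f v| ≤ A / ((supNorm (v - p) : ℝ) + 1) ^ a) (hg : ∀ v, |g v| ≤ A' / ((supNorm (v - q) : ℝ) + 1) ^ b) :
    Summable (fun v => f v * g v) ∧ |∑' v, f v * g v| ≤ A * A' * 162 := by
  have h := abs_tsum_mul_le_of_profiles p q (s := 0) (t := a + b) (by ring) (Nat.zero_le a) (Nat.zero_le b) hab hf hg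
  simpa only [pow_zero, mul_one] using h

/-! ## §4 Exponential locality is polynomial locality of every degree -/

/-- [folklore] **`e^{−δr} ≤ (e^δ·B!∕δ^B)∕(r+1)^B`** for `0 < δ`, `0 ≤ r` (from `x^B∕B! ≤ e^x` at `x = δ(r+1)`): an exponentially local kernel
`|C u v| ≤ c₀·e^{−δ‖u−v‖∞}` is `B`-polynomially local with constant `c₀·e^δ·B!∕δ^B`, so §3 applies. -/
theorem exp_neg_mul_le_div_pow {δ : ℝ} (hδ : 0 < δ) (B : ℕ) {r : ℝ} (hr : 0 ≤ r) :
    Real.exp (-(δ * r)) ≤ (Real.exp δ * B.factorial / δ ^ B) / (r + 1) ^ B := by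
  have hx : 0 ≤ δ * (r + 1) := by positivity
  have h := Real.pow_div_factorial_le_exp _ hx B
  -- `(δ(r+1))^B / B! ≤ e^{δ(r+1)} = e^{δ r} · e^{δ}`
  have hfac : (0 : ℝ) < B.factorial := by exact_mod_cast Nat.factorial_pos B
  have hr1 : (0 : ℝ) < (r + 1) ^ B := by positivity
  have hδB : (0 : ℝ) < δ ^ B := by positivity
  rw [mul_pow, div_le_iff₀ hfac] at h
  -- h : δ^B (r+1)^B ≤ exp (δ (r+1)) * B!
  rw [le_div_iff₀ hr1, le_div_iff₀ hδB]
  have e : Real.exp (δ * (r + 1)) = Real.exp (δ * r) * Real.exp δ := by rw [← Real.exp_add]; ring_nf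
  rw [e] at h
  have hpos : 0 < Real.exp (-(δ * r)) := Real.exp_pos _
  have key : Real.exp (-(δ * r)) * (δ ^ B * (r + 1) ^ B) ≤ Real.exp δ * B.factorial := by
    have := mul_le_mul_of_nonneg_left h hpos.le
    rw [show Real.exp (-(δ * r)) * (Real.exp (δ * r) * Real.exp δ * B.factorial) = Real.exp δ * B.factorial by
      rw [← mul_assoc, ← mul_assoc, ← Real.exp_add, neg_add_cancel, Real.exp_zero, one_mul]] at this
    exact this
  calc Real.exp (-(δ * r)) * (r + 1) ^ B * δ ^ B = Real.exp (-(δ * r)) * (δ ^ B * (r + 1) ^ B) := by ring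
    _ ≤ Real.exp δ * B.factorial := key

/-- [folklore] Lattice form: `c₀·e^{−δ‖w‖∞} ≤ (c₀·e^δ·B!∕δ^B)∕(‖w‖∞+1)^B` for `0 ≤ c₀`. -/
theorem exp_neg_supNorm_le_div_pow {δ c₀ : ℝ} (hδ : 0 < δ) (hc : 0 ≤ c₀) (B : ℕ) (w : Pt) :
    c₀ * Real.exp (-(δ * supNorm w)) ≤ (c₀ * (Real.exp δ * B.factorial / δ ^ B)) / ((supNorm w : ℝ) + 1) ^ B := by
  rw [mul_div_assoc]
  exact mul_le_mul_of_nonneg_left (exp_neg_mul_le_div_pow hδ B (Nat.cast_nonneg _)) hc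

end Summit.QuantumFields.BalabanUV.Beta.FP.LatticeConvolutionBounds
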